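import Summits.QuantumFields.YangMills.Theorems.FemtoCurvatureSkewness.Negative.ZeroCoupling
import Summits.QuantumFields.YangMills.Theorems.FemtoCurvatureSkewness.Negative.WeakCoupling

/-!
# `LangevinControlUV.FemtoCurvatureSkewness`, line `coupling-cubic-response` — lemma A2:
the uniform analyticity polydisc of the source-extended torus partition function

Crux `stmt-QuantumFields-9365`, engine-internal lemma A2 (stub `ZsrcCRePos` of the registered
skeleton).  The source-extended torus partition function with three MARKED plaquette couplings
(corner `p₀ = (0;0,1)`, arms `p₂ = (n e₂;0,1)`, `p₃ = (n e₃;0,1)`) and COMPLEX sources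
`t : Fin 3 → ℂ`,
  `Z_L(β; t) = ∫ exp(−β S_W(U) − t₀ P₀(U) − t₁ P₂(U) − t₂ P₃(U)) dHaar^{⊗E}(U)`,
has strictly positive real part on the polydisc `‖t_i‖ < π/(12 N)` — for EVERY torus `L`, every
real `β`, every compact `G`.  Reason: `0 ≤ P ≤ 2N` (`plaq_nonneg`, `plaq_le`), so the imaginary
part of the exponent is bounded by `3 · (π/(12N)) · 2N = π/2` strictly, the integrand has positive
real part pointwise, and the Haar integral (a probability measure on the compact configuration
space) of a continuous pointwise-positive function is positive.

Consequence used by the line: the connected pressure `log Z_L(β; ·)` is holomorphic on a polydisc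
of radius independent of `(L, β)`, so `κ₃ = −∂³ log Z_L/∂t₀∂t₁∂t₂|₀` is a Cauchy contour average.

Tree objects only (`plaq`, `piHaar`, `wilsonAction`); no new definitions; no `sorry`.
-/

noncomputable section

namespace Summit.QuantumFields.YangMills.Theorems.FemtoCurvatureSkewness

open MeasureTheory Filter Topology
open Literature.MathematicalPhysics.QuantumFieldTheory
open Summit.QuantumFields.YangMills.Theorems.ContinuumLimitOnTrajectory.Negative (piHaar)
open Summit.QuantumFields.YangMills.Theorems.FemtoCurvatureSkewness.Negative
  (plaq continuous_plaq plaq_nonneg plaq_le)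

/-- **Lemma A2 (uniform source polydisc).**  For every compact group `G`, lattice representation
`r`, torus size `L`, real coupling `β`, separation `n` and complex sources `t : Fin 3 → ℂ` with
`‖t_i‖ < π/(12 N)`, the source-extended torus partition function
`∫ exp(−β S_W − t₀ P_{(0;0,1)} − t₁ P_{(ne₂;0,1)} − t₂ P_{(ne₃;0,1)}) dHaar^{⊗E}`
has strictly positive real part. -/
theorem ZsrcCRePos : ∀ (G : Type) [Group G] [TopologicalSpace G] [IsTopologicalGroup G] [CompactSpace G] [MeasurableSpace G] [BorelSpace G] (r : LatticeRep G) (L : ℕ) [NeZero L] (β : ℝ) (n : ℕ) (t : Fin 3 → ℂ), (∀ i, ‖t i‖ < Real.pi / (12 * r.N)) → 0 < (∫ U, Complex.exp (-((β * wilsonAction (d := 4) (L := L) r.ρ U : ℝ) : ℂ) - t 0 * (plaq r L 0 0 1 U : ℂ) - t 1 * (plaq r L (Pi.single (2 : Fin 4) ((n : ℕ) : ZMod L)) 0 1 U : ℂ) - t 2 * (plaq r L (Pi.single (3 : Fin 4) ((n : ℕ) : ZMod L)) 0 1 U : ℂ)) ∂piHaar L).re := by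
  intro G _ _ _ _ _ _ r L _ β n t ht
  classical
  haveI : SecondCountableTopology G :=
    (r.continuous.isClosedEmbedding r.injective).isEmbedding.secondCountableTopology
  -- `N ≥ 1`, else the hypothesis is void
  have hN : 0 < (r.N : ℝ) := by
    by_contra h
    have h0 : (r.N : ℝ) = 0 := le_antisymm (not_lt.1 h) (Nat.cast_nonneg _)
    have := ht 0
    rw [h0, mul_zero, div_zero] at this
    exact absurd this (not_lt.2 (norm_nonneg _))
  -- the two arm sites
  set y : Site 4 L := Pi.single (2 : Fin 4) ((n : ℕ) : ZMod L) with hy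
  set z : Site 4 L := Pi.single (3 : Fin 4) ((n : ℕ) : ZMod L) with hz
  -- the exponent and its continuity
  set w : GaugeConfig 4 L G → ℂ := fun U => -((β * wilsonAction (d := 4) (L := L) r.ρ U : ℝ) : ℂ)
      - t 0 * (plaq r L 0 0 1 U : ℂ) - t 1 * (plaq r L y 0 1 U : ℂ)
      - t 2 * (plaq r L z 0 1 U : ℂ) with hw
  have hS : Continuous (wilsonAction (d := 4) (L := L) r.ρ : GaugeConfig 4 L G → ℝ) :=
    Literature.Barriers.QuantumFields.Elitzur.continuous_wilsonAction r.ρ r.continuous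
  have hP : ∀ x : Site 4 L, Continuous (plaq r L x 0 1 : GaugeConfig 4 L G → ℝ) :=
    fun x => continuous_plaq r L x 0 1
  have hwc : Continuous w := by
    have h1 : Continuous fun U : GaugeConfig 4 L G =>
        ((β * wilsonAction (d := 4) (L := L) r.ρ U : ℝ) : ℂ) :=
      Complex.continuous_ofReal.comp (continuous_const.mul hS)
    have h2 : ∀ x : Site 4 L, Continuous fun U : GaugeConfig 4 L G => (plaq r L x 0 1 U : ℂ) :=
      fun x => Complex.continuous_ofReal.comp (hP x)
    exact ((h1.neg.sub (continuous_const.mul (h2 0))).sub (continuous_const.mul (h2 _))).sub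
      (continuous_const.mul (h2 _))
  have hfc : Continuous fun U => Complex.exp (w U) := Complex.continuous_exp.comp hwc
  have hfi : Integrable (fun U => Complex.exp (w U)) (piHaar L) :=
    hfc.integrable_of_hasCompactSupport (HasCompactSupport.of_compactSpace _)
  -- pointwise: the imaginary part of the exponent stays in (-π/2, π/2)
  have hbound : ∀ (i : Fin 3) (x : Site 4 L) (U : GaugeConfig 4 L G),
      |(t i).im * plaq r L x 0 1 U| ≤ ‖t i‖ * (2 * r.N) := fun i x U => by
    rw [abs_mul, abs_of_nonneg (plaq_nonneg r L x 0 1 U)]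
    exact mul_le_mul (Complex.abs_im_le_norm _) (plaq_le r L x 0 1 U) (plaq_nonneg r L x 0 1 U)
      (norm_nonneg _)
  have him : ∀ U, |(w U).im| < Real.pi / 2 := fun U => by
    have hwim : (w U).im = -((t 0).im * plaq r L 0 0 1 U) - (t 1).im * plaq r L y 0 1 U
        - (t 2).im * plaq r L z 0 1 U := by
      simp [hw, Complex.mul_im]
    rw [hwim]
    have h0 := hbound 0 0 U
    have h1 := hbound 1 y U
    have h2 := hbound 2 z U
    have ht' : ∀ i, ‖t i‖ * (2 * r.N) < Real.pi / 6 := fun i => by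
      have := mul_lt_mul_of_pos_right (ht i) (by positivity : (0 : ℝ) < 2 * r.N)
      calc ‖t i‖ * (2 * r.N) < Real.pi / (12 * r.N) * (2 * r.N) := this
        _ = Real.pi / 6 := by field_simp; ring
    have key : |-((t 0).im * plaq r L 0 0 1 U) - (t 1).im * plaq r L y 0 1 U
        - (t 2).im * plaq r L z 0 1 U|
        ≤ |(t 0).im * plaq r L 0 0 1 U| + |(t 1).im * plaq r L y 0 1 U|
          + |(t 2).im * plaq r L z 0 1 U| := by
      have a1 := abs_sub (-((t 0).im * plaq r L 0 0 1 U) - (t 1).im * plaq r L y 0 1 U)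
        ((t 2).im * plaq r L z 0 1 U)
      have a2 := abs_sub (-((t 0).im * plaq r L 0 0 1 U)) ((t 1).im * plaq r L y 0 1 U)
      rw [abs_neg] at a2
      linarith
    linarith [ht' 0, ht' 1, ht' 2]
  have hpos : ∀ U, 0 < (Complex.exp (w U)).re := fun U => by
    rw [Complex.exp_re]
    have hh := abs_lt.1 (him U)
    exact mul_pos (Real.exp_pos _) (Real.cos_pos_of_mem_Ioo ⟨by linarith [hh.1], by linarith [hh.2]⟩)
  -- real part of the integral = integral of the real part
  have hre : (∫ U, Complex.exp (w U) ∂piHaar L).re = ∫ U, (Complex.exp (w U)).re ∂piHaar L := by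
    have key := Complex.reCLM.integral_comp_comm hfi
    simp only [Complex.reCLM_apply] at key
    rw [key]
  change 0 < (∫ U, Complex.exp (w U) ∂piHaar L).re
  rw [hre]
  have hgi : Integrable (fun U => (Complex.exp (w U)).re) (piHaar L) := hfi.re
  rw [integral_pos_iff_support_of_nonneg (fun U => (hpos U).le) hgi]
  have hsupp : Function.support (fun U => (Complex.exp (w U)).re) = Set.univ := by
    ext U
    simp only [Function.mem_support, ne_eq, Set.mem_univ, iff_true]
    exact (hpos U).ne'
  rw [hsupp, measure_univ]
  exact one_pos

end Summit.QuantumFields.YangMills.Theorems.FemtoCurvatureSkewness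

end
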